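import Literature.Analysis.FluidPDE.RieszPressureModConstKernel
import HarnessLib

/-!
# The Riesz pressure of a bounded field, modulo constants

Analysis/FluidPDE support file (two definitions, all results proved; no named facts). For a
velocity slice `v : ℝ³ → ℝ³` that is merely **bounded** and `C²` (bounded mild / Type-I-in-time
ancient solutions of Koch–Nadirashvili–Seregin–Šverák 2009; Seregin 2014, §6.2–§6.3) the Riesz
pressure `RᵢRⱼ(vᵢvⱼ)` is a `BMO` function determined modulo constants (Seregin 2014, Lemma 6.5:
`Δq_F = −div div F`, `q_F ∈ BMO`, unique after the normalisation `[q_F]_{B(1)} = 0`). The tree's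
pressure potential `pressurePotential v = −Q₁[v] − Q₂[v]` (`PressureRepresentation`; near/far
splitting `Γ = Γ₀ + Γ∞` of the Newtonian kernel, Gilbarg–Trudinger Lemma 4.2) needs
`|v|² ∈ L¹` for the far part `Q₂[v] = ∫ D²Γ∞(x−y)(v y, v y) dy`. Here the far kernel is taken
**modulo its value at a base point `x₀`**:

* `farPotentialMod r₀ r₁ x₀ v x = ∫ (D²Γ∞(x−y) − D²Γ∞(x₀−y))(v y, v y) dy` — absolutely
  convergent for bounded continuous `v` (the kernel difference is `O(|y|⁻⁴)`,
  `RieszPressureModConstKernel`), continuous in `x`, additive under change of base point;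
* `pressurePotentialMod x₀ v = −Q₁[v] − farPotentialMod 1 2 x₀ v`;
* the **growth bound** `|Q̃(x) − Q̃(x')| ≤ 2 N_G ‖Γ₀‖₁ + A N² √(1+|x−x'|)` (`N` a bound for `v`,
  `N_G` for the source `G[v] = ∂ᵢ∂ⱼ(vᵢvⱼ)`), from the `L¹` translation modulus of `D²Γ∞`, and
  its integrated form on balls (what Tao's probe argument consumes);
* (companion file `RieszPressureModConstPoisson`) the **weak pressure Poisson equation**
  `∫ Q̃ Δφ = −∫ D²φ(v, v)` for every test function `φ`.

This is the slice-wise object of the identification «classical pressure of a bounded Oseen-mild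
solution `=` Riesz pressure `+ c(t)`» (`BoundedMildPressureIdentification`).

## References

* G. Seregin, *Lecture Notes on Regularity Theory for the Navier–Stokes Equations*, World
  Scientific 2014, §6.2 Lemma 6.5, Thm 2.6, Remarks 6.2–6.4; §6.3 Def. 6.3. [Seregin2014]
* G. Koch, N. Nadirashvili, G. Seregin, V. Šverák, Acta Math. 203 (2009) = arXiv:0709.3599,
  §3–§4. [KochNadirashviliSereginSverak2009]
* D. Gilbarg, N. S. Trudinger, *Elliptic PDE of Second Order* (2001), Lemma 4.2, (2.14).
  [GilbargTrudinger2001]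
* T. Tao, Anal. PDE 6 (2013) = arXiv:1108.1165, §4 Lemma 4.1 (i). [Tao2011]

## Mathlib / tree search

Tree: `nearPotential`, `laplacian_nearPotential`, `contDiff_nearPotential`,
`integral_mul_pressureSource`, `integral_comp_sub_mul_pressureSource`,
`sum_fderiv4_newtonFar_apply`, `integral_mul_laplacian_comm`, `integrable_newtonNear`
(`PressureRepresentation`, `NewtonPotential`, `NewtonKernel`). Mathlib: `continuousAt_of_dominated`,
`integral_integral_swap`, `Integrable.mul_prod`, `integral_sub_left_eq_self`,
`Measure.addHaar_real_closedBall`.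
-/

noncomputable section

open MeasureTheory Set Filter Metric Topology InnerProductSpace Function
open scoped RealInnerProductSpace ContDiff ENNReal Laplacian

namespace Literature.Analysis.FluidPDE

open Literature.Analysis.FluidPDE.FourierNS (HasDecay)
open Literature.Analysis.FluidPDE.PineauVicol2026
open RieszPressureModConst

-- nested operator types `ℝ³ →L[ℝ] ℝ³ →L[ℝ] ℝ³ →L[ℝ] ℝ`
set_option maxSynthPendingDepth 3

/-! ### Definitions -/

/-- **The far potential modulo constants**:
`farPotentialMod r₀ r₁ x₀ v x = ∫ (D²Γ∞(x−y) − D²Γ∞(x₀−y))(v y, v y) dy`, the far part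
`(D²Γ∞) * (v ⊗ v)` of the Riesz pressure of a bounded field renormalised by its value at the base
point `x₀` (Seregin 2014, §6.2, the `BMO` pressure `p_{u⊗u}` of Lemma 6.5 / Thm 2.6, realised
through the near/far splitting of Gilbarg–Trudinger Lemma 4.2; for `|v|² ∈ L¹` it equals
`Q₂[v](x) − Q₂[v](x₀)`). Bochner integral, absolutely convergent for bounded continuous `v`.
[cite: Seregin2014, §6.2 Lemma 6.5] -/
def farPotentialMod (r₀ r₁ : ℝ) (x₀ : EuclideanSpace ℝ (Fin 3))
    (v : EuclideanSpace ℝ (Fin 3) → EuclideanSpace ℝ (Fin 3)) (x : EuclideanSpace ℝ (Fin 3)) : ℝ :=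
  ∫ y, (fderiv ℝ (fderiv ℝ (newtonFar r₀ r₁)) (x - y) -
    fderiv ℝ (fderiv ℝ (newtonFar r₀ r₁)) (x₀ - y)) (v y) (v y)

/-- **The Riesz pressure of a bounded field modulo constants**:
`pressurePotentialMod x₀ v = −Q₁[v] − farPotentialMod 1 2 x₀ v` (cutoff radii `1, 2` as in the
tree's `pressurePotential`), a representative of `RᵢRⱼ(vᵢvⱼ) = −Δ⁻¹∂ᵢ∂ⱼ(vᵢvⱼ)` normalised at
the base point `x₀` (Seregin 2014, Lemma 6.5 normalises by `[q]_{B(1)} = 0` instead; the two differ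
by a constant). [cite: Seregin2014, §6.2 Lemma 6.5] -/
def pressurePotentialMod (x₀ : EuclideanSpace ℝ (Fin 3))
    (v : EuclideanSpace ℝ (Fin 3) → EuclideanSpace ℝ (Fin 3)) (x : EuclideanSpace ℝ (Fin 3)) : ℝ :=
  -nearPotential 1 2 v x - farPotentialMod 1 2 x₀ v x

/-! ### The far potential modulo constants: convergence, continuity, base change -/

section Far

variable {r₀ r₁ : ℝ}

/-- `(1 + |y|)⁻⁴` is integrable on `ℝ³` (private helper). [folklore] -/
private theorem integrable_inv_one_add_norm_pow_four' :
    Integrable fun y : EuclideanSpace ℝ (Fin 3) => ((1 + ‖y‖) ^ 4)⁻¹ := by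
  have h := integrable_one_add_norm (E := EuclideanSpace ℝ (Fin 3)) (μ := volume) (r := 4)
    (by simp; norm_num)
  refine h.congr (Eventually.of_forall fun y => ?_)
  have h0 : 0 < 1 + ‖y‖ := by positivity
  show (1 + ‖y‖) ^ (-(4 : ℝ)) = ((1 + ‖y‖) ^ 4)⁻¹
  rw [Real.rpow_neg h0.le, show (4 : ℝ) = ((4 : ℕ) : ℝ) by norm_num, Real.rpow_natCast]

/-- **The dominator of the renormalised far integrand**: there is `M ≥ 0` (depending on the
cutoff radii only) with `‖(D²Γ∞(x−y) − D²Γ∞(x₀−y))(v y, v y)‖ ≤ M (1+ρ)⁴ ‖x−x₀‖ N² (1+|y|)⁻⁴`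
whenever `|x|, |x₀| ≤ ρ` and `|v| ≤ N` (mean-value majorant of `RieszPressureModConstKernel`).
[cite: GilbargTrudinger2001, (2.14)] -/
theorem exists_norm_farPotentialMod_integrand_le (h₀ : 0 < r₀) (h₁ : r₀ < r₁) :
    ∃ M, 0 ≤ M ∧ ∀ (v : EuclideanSpace ℝ (Fin 3) → EuclideanSpace ℝ (Fin 3)) (N : ℝ),
      (∀ y, ‖v y‖ ≤ N) → ∀ (ρ : ℝ) (x x₀ y : EuclideanSpace ℝ (Fin 3)), ‖x‖ ≤ ρ → ‖x₀‖ ≤ ρ →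
      ‖(fderiv ℝ (fderiv ℝ (newtonFar r₀ r₁)) (x - y) -
          fderiv ℝ (fderiv ℝ (newtonFar r₀ r₁)) (x₀ - y)) (v y) (v y)‖ ≤
        M * (1 + ρ) ^ 4 * ‖x - x₀‖ * N ^ 2 * ((1 + ‖y‖) ^ 4)⁻¹ := by
  obtain ⟨M, hM0, hM⟩ := exists_norm_fderiv2_newtonFar_sub_sub_le h₀ h₁
  refine ⟨M, hM0, fun v N hN ρ x x₀ y hx hx₀ => ?_⟩
  have hN0 : 0 ≤ N := (norm_nonneg _).trans (hN y)
  set D := fderiv ℝ (fderiv ℝ (newtonFar r₀ r₁)) (x - y) -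
    fderiv ℝ (fderiv ℝ (newtonFar r₀ r₁)) (x₀ - y) with hD
  calc ‖D (v y) (v y)‖ ≤ ‖D (v y)‖ * ‖v y‖ := ContinuousLinearMap.le_opNorm _ _
    _ ≤ ‖D‖ * ‖v y‖ * ‖v y‖ := by gcongr; exact ContinuousLinearMap.le_opNorm _ _
    _ ≤ (M * (1 + ρ) ^ 4 * ‖x - x₀‖ * ((1 + ‖y‖) ^ 4)⁻¹) * N * N := by
        gcongr
        · exact hM ρ x x₀ y hx hx₀
        · exact hN y
        · exact hN y
    _ = M * (1 + ρ) ^ 4 * ‖x - x₀‖ * N ^ 2 * ((1 + ‖y‖) ^ 4)⁻¹ := by ring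

/-- The renormalised far integrand is continuous in `y`. [folklore] -/
private theorem continuous_farPotentialMod_integrand (h₀ : 0 < r₀) (h₁ : r₀ < r₁)
    {v : EuclideanSpace ℝ (Fin 3) → EuclideanSpace ℝ (Fin 3)} (hv : Continuous v)
    (x₀ x : EuclideanSpace ℝ (Fin 3)) :
    Continuous fun y => (fderiv ℝ (fderiv ℝ (newtonFar r₀ r₁)) (x - y) -
      fderiv ℝ (fderiv ℝ (newtonFar r₀ r₁)) (x₀ - y)) (v y) (v y) := by
  have hKc : Continuous (fderiv ℝ (fderiv ℝ (newtonFar r₀ r₁))) :=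
    (contDiff_fderiv2_newtonFar h₀ h₁).continuous
  exact (((hKc.comp (continuous_const.sub continuous_id)).sub
    (hKc.comp (continuous_const.sub continuous_id))).clm_apply hv).clm_apply hv

/-- **Absolute convergence**: for bounded continuous `v` the renormalised far integrand is
integrable, at every `x` and every base point `x₀` (Seregin 2014, Lemma 6.5: the `BMO` pressure of
an `L^∞` tensor exists). [cite: Seregin2014, §6.2 Lemma 6.5] -/
theorem integrable_farPotentialMod_integrand (h₀ : 0 < r₀) (h₁ : r₀ < r₁)
    {v : EuclideanSpace ℝ (Fin 3) → EuclideanSpace ℝ (Fin 3)} (hv : Continuous v) {N : ℝ}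
    (hN : ∀ y, ‖v y‖ ≤ N) (x₀ x : EuclideanSpace ℝ (Fin 3)) :
    Integrable fun y => (fderiv ℝ (fderiv ℝ (newtonFar r₀ r₁)) (x - y) -
      fderiv ℝ (fderiv ℝ (newtonFar r₀ r₁)) (x₀ - y)) (v y) (v y) := by
  obtain ⟨M, hM0, hM⟩ := exists_norm_farPotentialMod_integrand_le h₀ h₁
  set ρ := max ‖x‖ ‖x₀‖ with hρ
  refine Integrable.mono'
    (integrable_inv_one_add_norm_pow_four'.const_mul (M * (1 + ρ) ^ 4 * ‖x - x₀‖ * N ^ 2))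
    (continuous_farPotentialMod_integrand h₀ h₁ hv x₀ x).aestronglyMeasurable
    (Eventually.of_forall fun y => hM v N hN ρ x x₀ y (le_max_left _ _) (le_max_right _ _))

/-- **Continuity** of `x ↦ farPotentialMod r₀ r₁ x₀ v x` for bounded continuous `v` (dominated
convergence on unit balls against `(1+|y|)⁻⁴`). [cite: Seregin2014, §6.2 Lemma 6.5] -/
theorem continuous_farPotentialMod (h₀ : 0 < r₀) (h₁ : r₀ < r₁)
    {v : EuclideanSpace ℝ (Fin 3) → EuclideanSpace ℝ (Fin 3)} (hv : Continuous v) {N : ℝ}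
    (hN : ∀ y, ‖v y‖ ≤ N) (x₀ : EuclideanSpace ℝ (Fin 3)) :
    Continuous (farPotentialMod r₀ r₁ x₀ v) := by
  obtain ⟨M, hM0, hM⟩ := exists_norm_farPotentialMod_integrand_le h₀ h₁
  refine continuous_iff_continuousAt.2 fun x₁ => ?_
  set ρ := max (‖x₁‖ + 1) ‖x₀‖ with hρ
  have hρ0 : 0 ≤ ρ := le_max_of_le_left (by positivity)
  unfold farPotentialMod
  refine continuousAt_of_dominated
    (bound := fun y => M * (1 + ρ) ^ 4 * (2 * ρ) * N ^ 2 * ((1 + ‖y‖) ^ 4)⁻¹) ?_ ?_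
    (integrable_inv_one_add_norm_pow_four'.const_mul _) ?_
  · exact Eventually.of_forall fun x =>
      (continuous_farPotentialMod_integrand h₀ h₁ hv x₀ x).aestronglyMeasurable
  · have hball : ball x₁ 1 ∈ 𝓝 x₁ := ball_mem_nhds x₁ one_pos
    filter_upwards [hball] with x hx
    rw [mem_ball_iff_norm] at hx
    have hxρ : ‖x‖ ≤ ρ := by
      have : ‖x‖ ≤ ‖x - x₁‖ + ‖x₁‖ := norm_le_norm_sub_add x x₁
      exact le_max_of_le_left (by linarith)
    have hx₀ρ : ‖x₀‖ ≤ ρ := le_max_right _ _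
    refine Eventually.of_forall fun y => (hM v N hN ρ x x₀ y hxρ hx₀ρ).trans ?_
    have hN2 : 0 ≤ N ^ 2 := sq_nonneg N
    have hxx : ‖x - x₀‖ ≤ 2 * ρ := (norm_sub_le x x₀).trans (by linarith)
    have h4 : 0 ≤ ((1 + ‖y‖) ^ 4)⁻¹ := by positivity
    have : M * (1 + ρ) ^ 4 * ‖x - x₀‖ ≤ M * (1 + ρ) ^ 4 * (2 * ρ) :=
      mul_le_mul_of_nonneg_left hxx (by positivity)
    exact mul_le_mul_of_nonneg_right (mul_le_mul_of_nonneg_right this hN2) h4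
  · refine Eventually.of_forall fun y => ?_
    have hc : Continuous fun x => (fderiv ℝ (fderiv ℝ (newtonFar r₀ r₁)) (x - y) -
        fderiv ℝ (fderiv ℝ (newtonFar r₀ r₁)) (x₀ - y)) (v y) (v y) :=
      ((((contDiff_fderiv2_newtonFar h₀ h₁).continuous.comp (continuous_id.sub continuous_const)).sub
        continuous_const).clm_apply continuous_const).clm_apply continuous_const
    exact hc.continuousAt

/-- **Change of base point is a constant shift**:
`farPotentialMod r₀ r₁ x₀ v x − farPotentialMod r₀ r₁ x₀' v x = farPotentialMod r₀ r₁ x₀ v x₀'`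
(independent of `x`). [cite: Seregin2014, §6.2 Lemma 6.5] -/
theorem farPotentialMod_sub_farPotentialMod_base (h₀ : 0 < r₀) (h₁ : r₀ < r₁)
    {v : EuclideanSpace ℝ (Fin 3) → EuclideanSpace ℝ (Fin 3)} (hv : Continuous v) {N : ℝ}
    (hN : ∀ y, ‖v y‖ ≤ N) (x₀ x₀' x : EuclideanSpace ℝ (Fin 3)) :
    farPotentialMod r₀ r₁ x₀ v x - farPotentialMod r₀ r₁ x₀' v x = farPotentialMod r₀ r₁ x₀ v x₀' := by
  unfold farPotentialMod
  rw [← integral_sub (integrable_farPotentialMod_integrand h₀ h₁ hv hN x₀ x)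
    (integrable_farPotentialMod_integrand h₀ h₁ hv hN x₀' x)]
  refine integral_congr_ae (Eventually.of_forall fun y => ?_)
  simp only [sub_apply]
  ring

/-- **Differences are renormalised far potentials**:
`farPotentialMod r₀ r₁ x₀ v x − farPotentialMod r₀ r₁ x₀ v x' = farPotentialMod r₀ r₁ x' v x`.
[cite: Seregin2014, §6.2 Lemma 6.5] -/
theorem farPotentialMod_sub_farPotentialMod (h₀ : 0 < r₀) (h₁ : r₀ < r₁)
    {v : EuclideanSpace ℝ (Fin 3) → EuclideanSpace ℝ (Fin 3)} (hv : Continuous v) {N : ℝ}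
    (hN : ∀ y, ‖v y‖ ≤ N) (x₀ x x' : EuclideanSpace ℝ (Fin 3)) :
    farPotentialMod r₀ r₁ x₀ v x - farPotentialMod r₀ r₁ x₀ v x' = farPotentialMod r₀ r₁ x' v x := by
  unfold farPotentialMod
  rw [← integral_sub (integrable_farPotentialMod_integrand h₀ h₁ hv hN x₀ x)
    (integrable_farPotentialMod_integrand h₀ h₁ hv hN x₀ x')]
  refine integral_congr_ae (Eventually.of_forall fun y => ?_)
  simp only [sub_apply]
  ring

/-- **The renormalised far potential is controlled by the translation modulus of the kernel**:
`|farPotentialMod r₀ r₁ x' v x| ≤ N² ∫ ‖D²Γ∞(z + (x − x')) − D²Γ∞(z)‖ dz`. [cite: Seregin2014, §6.2 Lemma 6.5] -/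
theorem abs_farPotentialMod_le_modulus (h₀ : 0 < r₀) (h₁ : r₀ < r₁)
    {v : EuclideanSpace ℝ (Fin 3) → EuclideanSpace ℝ (Fin 3)} {N : ℝ}
    (hN : ∀ y, ‖v y‖ ≤ N) (x x' : EuclideanSpace ℝ (Fin 3)) :
    |farPotentialMod r₀ r₁ x' v x| ≤ N ^ 2 * ∫ z, ‖fderiv ℝ (fderiv ℝ (newtonFar r₀ r₁)) (z + (x - x')) -
      fderiv ℝ (fderiv ℝ (newtonFar r₀ r₁)) z‖ := by
  set K := fderiv ℝ (fderiv ℝ (newtonFar r₀ r₁)) with hK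
  obtain ⟨A, -, hA⟩ := exists_integral_norm_fderiv2_newtonFar_translate_sub_le h₀ h₁
  have hmod := (hA (x - x')).1
  -- `∫ ‖K(x−y) − K(x'−y)‖ dy = ∫ ‖K(z + (x−x')) − K z‖ dz` (substitute `z = x' − y`)
  have hsub : ∫ y, ‖K (x - y) - K (x' - y)‖ = ∫ z, ‖K (z + (x - x')) - K z‖ := by
    have h := integral_sub_left_eq_self (fun z => ‖K (z + (x - x')) - K z‖) volume x'
    rw [← h]
    refine integral_congr_ae (Eventually.of_forall fun y => ?_)
    simp only
    rw [show x' - y + (x - x') = x - y by abel]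
  have hint : Integrable (fun y => ‖K (x - y) - K (x' - y)‖) := by
    have h := hmod.comp_sub_left x'
    refine h.congr (Eventually.of_forall fun y => ?_)
    simp only
    rw [show x' - y + (x - x') = x - y by abel]
  have hN0 : 0 ≤ N := (norm_nonneg _).trans (hN 0)
  unfold farPotentialMod
  rw [← Real.norm_eq_abs]
  calc ‖∫ y, (K (x - y) - K (x' - y)) (v y) (v y)‖
      ≤ ∫ y, ‖K (x - y) - K (x' - y)‖ * N ^ 2 := by
        refine norm_integral_le_of_norm_le (hint.mul_const _) (Eventually.of_forall fun y => ?_)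
        calc ‖(K (x - y) - K (x' - y)) (v y) (v y)‖
            ≤ ‖(K (x - y) - K (x' - y)) (v y)‖ * ‖v y‖ := ContinuousLinearMap.le_opNorm _ _
          _ ≤ ‖K (x - y) - K (x' - y)‖ * ‖v y‖ * ‖v y‖ := by
              gcongr; exact ContinuousLinearMap.le_opNorm _ _
          _ ≤ ‖K (x - y) - K (x' - y)‖ * N * N := by gcongr <;> exact hN y
          _ = ‖K (x - y) - K (x' - y)‖ * N ^ 2 := by ring
    _ = N ^ 2 * ∫ z, ‖K (z + (x - x')) - K z‖ := by
        rw [integral_mul_const, hsub, mul_comm]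

/-- **Growth of the renormalised far potential**: there is `A ≥ 0` (cutoff radii only) with
`|farPotentialMod r₀ r₁ x' v x| ≤ A N² √(1 + |x − x'|)` for all bounded continuous `v`
(`|v| ≤ N`) — the `L¹` translation modulus of `D²Γ∞` (the sharp order is `log |x − x'|`, a `BMO`
statement: Seregin 2014, Lemma 6.5). [cite: Seregin2014, §6.2 Lemma 6.5] -/
theorem exists_abs_farPotentialMod_le_sqrt (h₀ : 0 < r₀) (h₁ : r₀ < r₁) :
    ∃ A, 0 ≤ A ∧ ∀ (v : EuclideanSpace ℝ (Fin 3) → EuclideanSpace ℝ (Fin 3)) (N : ℝ),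
      (∀ y, ‖v y‖ ≤ N) → ∀ x x' : EuclideanSpace ℝ (Fin 3),
      |farPotentialMod r₀ r₁ x' v x| ≤ A * N ^ 2 * Real.sqrt (1 + ‖x - x'‖) := by
  obtain ⟨A, hA0, hA⟩ := exists_integral_norm_fderiv2_newtonFar_translate_sub_le h₀ h₁
  refine ⟨A, hA0, fun v N hN x x' => ?_⟩
  calc |farPotentialMod r₀ r₁ x' v x| ≤ N ^ 2 * ∫ z, ‖fderiv ℝ (fderiv ℝ (newtonFar r₀ r₁)) (z + (x - x')) -
        fderiv ℝ (fderiv ℝ (newtonFar r₀ r₁)) z‖ := abs_farPotentialMod_le_modulus h₀ h₁ hN x x'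
    _ ≤ N ^ 2 * (A * Real.sqrt (1 + ‖x - x'‖)) :=
        mul_le_mul_of_nonneg_left (hA (x - x')).2 (sq_nonneg N)
    _ = A * N ^ 2 * Real.sqrt (1 + ‖x - x'‖) := by ring

end Far

/-! ### The near part and the growth bound of `Q̃` -/

section Growth

variable {r₀ r₁ : ℝ}

/-- **Sup bound for the near potential**: `|Q₁[v](x)| ≤ N_G ∫|Γ₀|` whenever `|G[v]| ≤ N_G`
(`Γ₀ ∈ L¹`, Gilbarg–Trudinger Lemma 4.1). [cite: GilbargTrudinger2001, Lemma 4.1] -/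
theorem abs_nearPotential_le (h₀ : 0 ≤ r₀) (h₁ : r₀ < r₁)
    {v : EuclideanSpace ℝ (Fin 3) → EuclideanSpace ℝ (Fin 3)} {NG : ℝ}
    (hG : ∀ x, |pressureSource v x| ≤ NG) (x : EuclideanSpace ℝ (Fin 3)) :
    |nearPotential r₀ r₁ v x| ≤ NG * ∫ z, |newtonNear r₀ r₁ z| := by
  unfold nearPotential
  rw [← Real.norm_eq_abs]
  calc ‖∫ z, newtonNear r₀ r₁ z * pressureSource v (x - z)‖
      ≤ ∫ z, ‖newtonNear r₀ r₁ z‖ * NG := by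
        refine norm_integral_le_of_norm_le ((integrable_newtonNear h₀ h₁).norm.mul_const NG)
          (Eventually.of_forall fun z => ?_)
        rw [norm_mul, Real.norm_eq_abs, Real.norm_eq_abs]
        exact mul_le_mul_of_nonneg_left (hG _) (abs_nonneg _)
    _ = NG * ∫ z, |newtonNear r₀ r₁ z| := by
        rw [integral_mul_const, mul_comm]
        simp only [Real.norm_eq_abs]

/-- **Growth of the Riesz pressure modulo constants**: there is `A ≥ 0` such that for every
bounded continuous field (`|v| ≤ N`) with bounded source (`|G[v]| ≤ N_G`), every base point `x₀`
and all `x, x'`: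
`|Q̃(x) − Q̃(x')| ≤ 2 N_G ∫|Γ₀| + A N² √(1+|x−x'|)` — in particular `Q̃` has sublinear growth,
the quantitative shadow of `Q̃ ∈ BMO` (Seregin 2014, Lemma 6.5). [cite: Seregin2014, §6.2 Lemma 6.5] -/
theorem exists_abs_pressurePotentialMod_sub_le :
    ∃ A, 0 ≤ A ∧ ∀ (v : EuclideanSpace ℝ (Fin 3) → EuclideanSpace ℝ (Fin 3)), Continuous v →
      ∀ N NG : ℝ, (∀ y, ‖v y‖ ≤ N) → (∀ y, |pressureSource v y| ≤ NG) →
      ∀ x₀ x x' : EuclideanSpace ℝ (Fin 3),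
      |pressurePotentialMod x₀ v x - pressurePotentialMod x₀ v x'| ≤
        2 * NG * (∫ z, |newtonNear 1 2 z|) + A * N ^ 2 * Real.sqrt (1 + ‖x - x'‖) := by
  obtain ⟨A, hA0, hA⟩ := exists_abs_farPotentialMod_le_sqrt one_pos one_lt_two
  refine ⟨A, hA0, fun v hv N NG hN hG x₀ x x' => ?_⟩
  have h1 := abs_nearPotential_le zero_le_one one_lt_two hG x (v := v)
  have h2 := abs_nearPotential_le zero_le_one one_lt_two hG x' (v := v)
  have h3 := hA v N hN x x'
  have e : pressurePotentialMod x₀ v x - pressurePotentialMod x₀ v x' =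
      -(nearPotential 1 2 v x - nearPotential 1 2 v x') -
        (farPotentialMod 1 2 x₀ v x - farPotentialMod 1 2 x₀ v x') := by
    unfold pressurePotentialMod; ring
  rw [e, farPotentialMod_sub_farPotentialMod one_pos one_lt_two hv hN]
  calc |-(nearPotential 1 2 v x - nearPotential 1 2 v x') - farPotentialMod 1 2 x' v x|
      ≤ |-(nearPotential 1 2 v x - nearPotential 1 2 v x')| + |farPotentialMod 1 2 x' v x| :=
        abs_sub _ _
    _ ≤ (|nearPotential 1 2 v x| + |nearPotential 1 2 v x'|) + |farPotentialMod 1 2 x' v x| := by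
        gcongr
        rw [abs_neg]
        exact abs_sub _ _
    _ ≤ (NG * (∫ z, |newtonNear 1 2 z|) + NG * (∫ z, |newtonNear 1 2 z|)) +
          A * N ^ 2 * Real.sqrt (1 + ‖x - x'‖) := by gcongr
    _ = 2 * NG * (∫ z, |newtonNear 1 2 z|) + A * N ^ 2 * Real.sqrt (1 + ‖x - x'‖) := by ring

/-- **Continuity of `Q̃`** for `v ∈ C²` bounded (near part `C⁰` by the tree, far part by
dominated convergence). [cite: Seregin2014, §6.2 Lemma 6.5] -/
theorem continuous_pressurePotentialMod {v : EuclideanSpace ℝ (Fin 3) → EuclideanSpace ℝ (Fin 3)}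
    (hv : ContDiff ℝ 2 v) {N : ℝ} (hN : ∀ y, ‖v y‖ ≤ N) (x₀ : EuclideanSpace ℝ (Fin 3)) :
    Continuous (pressurePotentialMod x₀ v) := by
  have h1 : Continuous (nearPotential 1 2 v) :=
    (contDiff_nearPotential zero_le_one one_lt_two 0 (by exact_mod_cast hv)).continuous
  have h2 := continuous_farPotentialMod one_pos one_lt_two hv.continuous hN x₀
  unfold pressurePotentialMod
  exact h1.neg.sub h2

end Growth

end Literature.Analysis.FluidPDE

end
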